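import Literature.NumberTheory.QuadraticForms.HasseSymbolsRat
import Literature.NumberTheory.QuadraticForms.HasseProductBlocks
import HarnessLib

/-!
# Hasse products of integral frames: the local evaluations

Topic `NumberTheory/QuadraticForms`; namespace `Literature.NumberTheory.QuadraticForms`. Everything
here is proved. Elementary evaluations of Hasse products `∏_{i<j} s(Nᵢ, Nⱼ)` (`hasseProd`) of
families of non-zero **integers** for Serre's explicit local symbols of `ℚ` (`ratSignInfty`,
`ratSign p` of `HasseSymbolsRat.lean`), as needed for the signature of an even unimodular lattice
(Serre, *A Course in Arithmetic*, Ch. V §2.1 Remark 2 with §1.3.6 and Ch. IV §2.4, §3.1):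

* `hasseProd_ratSignInfty`: at infinity, `∏_{i<j} (Nᵢ, Nⱼ)_∞ = (-1)^{C(s,2)}`, `s` the number of
  negative entries (Serre IV §2.4: `ε_∞ = (-1)^{s(s-1)/2}`); `choose_two_mod_two`: the parity of
  `C(s, 2)` only depends on `s mod 4`.
* `hasseProd_ratSign_eq_one_of_not_dvd`: at an odd prime `p`, a family of `p`-units has Hasse
  product `1` (Serre V §1.3.6: `εₚ(E) = 1`).
* `hasseProd_ratSign_two_blocks`: at `2`, the frame `⟨2Aₖ⟩ ⊕ ⟨-2AₖDₖ⟩` (`Aₖ` odd, `Dₖ ≡ 1 mod 4`)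
  of the `2`-adic blocks has Hasse product `χ₈(∏ Dₖ) · (-1)^{C(m,2)}` (the computation behind
  Serre's value of `ε₂(E)`, V §1.3.6), from `hasseProd_append_mul_self` and the dyadic formula
  `(2^α u, 2^β w)_2 = (-1)^{ε(u)ε(w) + αω(w) + βω(u)}` (III §1.2 Thm. 1).
* `hasseProd_totalSign_eq_one`: Hilbert's product formula (III §2.1 Thm. 3, `totalSign_eq_one`)
  for Hasse products: `ε_∞ · ε₂ · ∏_{p ∈ S} εₚ = 1`.

## References

* J.-P. Serre, *A Course in Arithmetic*, GTM 7, Springer 1973, Ch. III §1.2 Thm. 1, §2.1 Thm. 3;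
  Ch. IV §2.4, §3.1; Ch. V §1.3.6, §2.1 (PDF pp. 20–23, 38–39, 46, 50). [Serre1973]
-/

noncomputable section

namespace Literature.NumberTheory.QuadraticForms

open Finset ZMod

/-! ### Hasse products of integer families -/

/-- On integer families the Hasse product for `ratSign p` is the double product of the explicit
integer signs `localSign p`. [folklore] -/
theorem hasseProd_ratSign_intCast (p : ℕ) {k : ℕ} (N : Fin k → ℤ) :
    hasseProd (ratSign p) (fun i => (N i : ℚ)) = ∏ i, ∏ j, if i < j then localSign p (N i) (N j) else 1 := by
  simp only [hasseProd, ratSign_intCast]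

/-- On integer families the Hasse product for `ratSignInfty` is the double product of
`localSignInfty`. [folklore] -/
theorem hasseProd_ratSignInfty_intCast {k : ℕ} (N : Fin k → ℤ) :
    hasseProd ratSignInfty (fun i => (N i : ℚ)) = ∏ i, ∏ j, if i < j then localSignInfty (N i) (N j) else 1 := by
  simp only [hasseProd, ratSignInfty_intCast]

/-- Two Hasse products with the same pair symbols agree. [folklore] -/
theorem hasseProd_congr_symbol {K : Type*} {s s' : K → K → ℤ} {k : ℕ} {a b : Fin k → K}
    (h : ∀ i j, i < j → s (a i) (a j) = s' (b i) (b j)) : hasseProd s a = hasseProd s' b := by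
  unfold hasseProd
  refine prod_congr rfl fun i _ => prod_congr rfl fun j _ => ?_
  split_ifs with hij
  · exact h i j hij
  · rfl

/-! ### The sign at infinity: `ε_∞ = (-1)^{C(s, 2)}` -/

/-- **Hasse product at infinity**: for a family of rationals, `∏_{i<j} (aᵢ, aⱼ)_∞ = (-1)^{C(s,2)}`
where `s` is the number of negative entries — each pair of negative entries contributes `-1`
(Serre, Ch. IV §2.4: `ε(f) = (-1)^{s(s-1)/2}` over `ℝ`). [cite: Serre1973, Ch. IV §2.4] -/
theorem hasseProd_ratSignInfty {k : ℕ} (a : Fin k → ℚ) :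
    hasseProd ratSignInfty a = (-1) ^ ((univ.filter fun i => a i < 0).card.choose 2) := by
  classical
  induction k with
  | zero => simp
  | succ k ih =>
    rw [hasseProd_eq_succAbove isHasseSymbol_ratSignInfty.comm a 0]
    simp only [Fin.succAbove_zero]
    rw [ih (fun j => a j.succ)]
    -- count of negative entries: head + tail
    have hcard : (univ.filter fun i : Fin (k + 1) => a i < 0).card =
        (if a 0 < 0 then 1 else 0) + (univ.filter fun j : Fin k => a j.succ < 0).card := by
      rw [Finset.card_filter, Finset.card_filter, Fin.sum_univ_succ]
    rw [hcard]
    by_cases h0 : a 0 < 0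
    · rw [if_pos h0]
      have hhead : (∏ j : Fin k, ratSignInfty (a 0) (a j.succ)) =
          (-1) ^ (univ.filter fun j : Fin k => a j.succ < 0).card := by
        simp only [ratSignInfty, h0, true_and]
        rw [Finset.prod_ite, Finset.prod_const, Finset.prod_const_one, mul_one]
      rw [hhead, ← pow_add, add_comm 1, Nat.choose_succ_succ, Nat.choose_one_right, add_comm]
    · rw [if_neg h0, zero_add]
      have hhead : (∏ j : Fin k, ratSignInfty (a 0) (a j.succ)) = 1 :=
        prod_eq_one fun j _ => by simp [ratSignInfty, h0]
      rw [hhead, one_mul]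

/-- A double product with all pair values `-1` is `(-1)^{C(k,2)}`. [folklore] -/
theorem prod_prod_ite_neg_one (k : ℕ) :
    (∏ i : Fin k, ∏ j : Fin k, if i < j then (-1 : ℤ) else 1) = (-1) ^ k.choose 2 := by
  have h := hasseProd_ratSignInfty (fun _ : Fin k => (-1 : ℚ))
  have hc : (univ.filter fun _ : Fin k => (-1 : ℚ) < 0).card = k := by simp
  rw [hc] at h
  rw [← h]
  unfold hasseProd
  refine prod_congr rfl fun i _ => prod_congr rfl fun j _ => ?_
  simp [ratSignInfty]

/-- `C(n+4, 2) = C(n, 2) + 4n + 6`. [folklore] -/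
theorem choose_two_add_four (n : ℕ) : (n + 4).choose 2 = n.choose 2 + (4 * n + 6) := by
  have h3 : (n + 4).choose 2 = (n + 3).choose 1 + (n + 3).choose 2 := Nat.choose_succ_succ (n + 3) 1
  have h2 : (n + 3).choose 2 = (n + 2).choose 1 + (n + 2).choose 2 := Nat.choose_succ_succ (n + 2) 1
  have h1 : (n + 2).choose 2 = (n + 1).choose 1 + (n + 1).choose 2 := Nat.choose_succ_succ (n + 1) 1
  have h0 : (n + 1).choose 2 = n.choose 1 + n.choose 2 := Nat.choose_succ_succ n 1
  rw [Nat.choose_one_right] at h3 h2 h1 h0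
  omega

/-- **The parity of `C(s, 2) = s(s-1)/2` depends only on `s mod 4`**: even for `s ≡ 0, 1`, odd
for `s ≡ 2, 3 (mod 4)` (Serre, Ch. IV §2.4: `ε = 1` if `s ≡ 0, 1 (mod 4)`, `-1` if
`s ≡ 2, 3 (mod 4)`). [cite: Serre1973, Ch. IV §2.4] -/
theorem choose_two_mod_two (s : ℕ) : s.choose 2 % 2 = if s % 4 < 2 then 0 else 1 := by
  induction s using Nat.strong_induction_on with
  | _ s ih =>
    rcases lt_or_ge s 4 with hs | hs
    · interval_cases s <;> decide
    · obtain ⟨n, rfl⟩ : ∃ n, s = n + 4 := ⟨s - 4, by omega⟩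
      rw [choose_two_add_four, Nat.add_mod, ih n (by omega)]
      have : (n + 4) % 4 = n % 4 := by omega
      rw [this]
      split_ifs <;> omega

/-! ### Odd primes: `p`-units have trivial symbols -/

/-- **`εₚ = 1` on `p`-units** (`p` odd): a family of integers prime to `p` has Hasse product `1`
for `ratSign p` (Serre, Ch. V §1.3.6: `εₚ(E) = 1` for `p ≠ 2`; Ch. III Thm. 1: `(u, w)_p = 1` for
units). [cite: Serre1973, Ch. V §1.3.6] -/
theorem hasseProd_ratSign_eq_one_of_not_dvd {p : ℕ} (hp : p.Prime) (hp2 : p ≠ 2) {k : ℕ}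
    (N : Fin k → ℤ) (hN : ∀ i, ¬ (p : ℤ) ∣ N i) :
    hasseProd (ratSign p) (fun i => (N i : ℚ)) = 1 := by
  rw [hasseProd_ratSign_intCast]
  refine prod_eq_one fun i _ => prod_eq_one fun j _ => ?_
  split_ifs
  · refine localSign_eq_one_of_not_dvd hp fun h => ?_
    have hpp : Prime (p : ℤ) := Nat.prime_iff_prime_int.mp hp
    rcases hpp.dvd_or_dvd h with h2 | h2
    · rcases hpp.dvd_or_dvd h2 with h3 | h3
      · have h' : (p : ℤ) ∣ ((2 : ℕ) : ℤ) := by simpa using h3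
        rw [Int.natCast_dvd_natCast] at h'
        exact hp2 ((Nat.prime_dvd_prime_iff_eq hp Nat.prime_two).mp h')
      · exact hN i h3
    · exact hN j h2
  · rfl

/-! ### The prime `2`: dyadic symbols of the block norms -/

section Two

/-- `localSign 2 = localSignTwo`. [folklore] -/
theorem localSign_two (a b : ℤ) : localSign 2 a b = localSignTwo a b := by
  simp [localSign]

/-- An integer not divisible by `2` is odd. [folklore] -/
theorem odd_of_not_two_dvd {x : ℤ} (h : ¬ (2 : ℤ) ∣ x) : Odd x :=
  Int.not_even_iff_odd.mp fun he => h (even_iff_two_dvd.mp he)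

/-- For `D ≡ 1 (mod 4)`: `χ₄(-D) = -1`. [folklore] -/
theorem χ₄_neg_of_mod_four {D t : ℤ} (hD : D = 4 * t + 1) : χ₄ ((-D : ℤ) : ZMod 4) = -1 := by
  have h : ((-D : ℤ) : ZMod 4) = ((3 : ℤ) : ZMod 4) := by
    rw [ZMod.intCast_eq_intCast_iff']
    omega
  rw [h]
  decide

/-- `χ₈(-x) = χ₈(x)` (`χ₈(-1) = 1`). [folklore] -/
theorem χ₈_intCast_neg (x : ℤ) : χ₈ ((-x : ℤ) : ZMod 8) = χ₈ ((x : ℤ) : ZMod 8) := by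
  rw [Int.cast_neg, ← neg_one_mul, map_mul]
  have : χ₈ (-1 : ZMod 8) = 1 := by decide
  rw [this, one_mul]

/-- An integer `≡ 1 (mod 4)` is odd. [folklore] -/
theorem not_two_dvd_of_mod_four {D t : ℤ} (hD : D = 4 * t + 1) : ¬ (2 : ℤ) ∣ D := by
  omega

/-- **Dyadic symbol of a block pair**: `(2A, -D)_2 = χ₄(A) χ₈(D)` for `A` odd and `D ≡ 1 (mod 4)`
(Serre's formula `(2^α u, 2^β w)_2 = (-1)^{ε(u)ε(w) + αω(w) + βω(u)}` with `α = 1`, `β = 0`,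
`ε(-D) = 1`). [cite: Serre1973, Ch. III §1.2 Thm. 1] -/
theorem localSignTwo_two_mul_neg {A D t : ℤ} (hA : ¬ (2 : ℤ) ∣ A) (hD : D = 4 * t + 1) :
    localSignTwo (2 * A) (-D) = χ₄ (A : ZMod 4) * χ₈ (D : ZMod 8) := by
  have hA0 : A ≠ 0 := fun h => hA (h ▸ dvd_zero 2)
  have hD2 : ¬ (2 : ℤ) ∣ -D := fun h => not_two_dvd_of_mod_four hD (dvd_neg.mp h)
  have hD0 : -D ≠ 0 := fun h => hD2 (h ▸ dvd_zero 2)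
  rw [localSignTwo_mul_left two_ne_zero hA0 hD0, localSignTwo_two_left hD2, localSignTwo_of_odd hA hD2,
    χ₈_intCast_neg]
  unfold epsSign
  rw [χ₄_neg_of_mod_four hD]
  simp only [and_true]
  rw [ite_χ₄_eq (odd_of_not_two_dvd hA), mul_comm]

/-- **Dyadic symbol of two block discriminants**: `(-D, -D')_2 = -1` for `D, D' ≡ 1 (mod 4)`
(`ε(-D) = ε(-D') = 1`). [cite: Serre1973, Ch. III §1.2 Thm. 1] -/
theorem localSignTwo_neg_neg {D D' t t' : ℤ} (hD : D = 4 * t + 1) (hD' : D' = 4 * t' + 1) :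
    localSignTwo (-D) (-D') = -1 := by
  have hD2 : ¬ (2 : ℤ) ∣ -D := fun h => not_two_dvd_of_mod_four hD (dvd_neg.mp h)
  have hD2' : ¬ (2 : ℤ) ∣ -D' := fun h => not_two_dvd_of_mod_four hD' (dvd_neg.mp h)
  rw [localSignTwo_of_odd hD2 hD2']
  unfold epsSign
  rw [χ₄_neg_of_mod_four hD, χ₄_neg_of_mod_four hD']
  simp

/-- **Dyadic symbol `(2^m u, 2^m u)_2 = χ₄(u)`** for odd `u` (`(x, x)_2 = (x, -1)_2`, and
`(2, -1)_2 = 1`, `(u, -1)_2 = (-1)^{ε(u)}`). [cite: Serre1973, Ch. III §1.2 Thm. 1] -/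
theorem localSignTwo_two_pow_mul_self {u : ℤ} (hu : ¬ (2 : ℤ) ∣ u) (m : ℕ) :
    localSignTwo (2 ^ m * u) (2 ^ m * u) = χ₄ (u : ZMod 4) := by
  have huodd : Odd u := odd_of_not_two_dvd hu
  obtain ⟨hv, hc⟩ := padicValInt_eq_of_eq_pow_mul (p := 2) (a := 2 ^ m * u) (u := u) (n := m)
    (by exact_mod_cast hu) (by push_cast; ring)
  unfold localSignTwo
  rw [hv, hc, mul_assoc, ← mul_pow, χ₈_mul_self_of_odd huodd, one_pow, mul_one]
  unfold epsSign
  simp only [and_self]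
  exact ite_χ₄_eq huodd

/-- `∏ₖ 2Aₖ = 2^m ∏ₖ Aₖ`. [folklore] -/
theorem prod_two_mul {m : ℕ} (A : Fin m → ℤ) : ∏ k, 2 * A k = 2 ^ m * ∏ k, A k := by
  rw [prod_mul_distrib, prod_const, card_univ, Fintype.card_fin]

/-- **`ε₂` of the block frame.** For integers `Aₖ` odd and `Dₖ ≡ 1 (mod 4)`, the Hasse product at
`2` of the frame `⟨2A₁, …, 2A_m, -2A₁D₁, …, -2A_mD_m⟩` is `χ₈(∏ Dₖ) · (-1)^{C(m,2)}`: by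
`hasseProd_append_mul_self` it is `(∏2A, ∏2A)_2 · ∏ₖ(2Aₖ, -Dₖ)_2 · ∏_{k<l}(-Dₖ, -Dₗ)_2
= χ₄(∏A) · ∏ₖ χ₄(Aₖ)χ₈(Dₖ) · (-1)^{C(m,2)}`. This is the computation behind Serre's value of `ε₂(E)`
for a type II lattice (Ch. V §1.3.6, "splitting `E ⊗ ℤ₂` in an orthogonal direct sum of modules of
rank 2"). [cite: Serre1973, Ch. V §1.3.6] -/
theorem hasseProd_ratSign_two_blocks {m : ℕ} (A D t : Fin m → ℤ) (hA : ∀ k, ¬ (2 : ℤ) ∣ A k)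
    (hD : ∀ k, D k = 4 * t k + 1) :
    hasseProd (ratSign 2) (Fin.append (fun k => ((2 * A k : ℤ) : ℚ))
      ((fun k => ((2 * A k : ℤ) : ℚ)) * fun k => ((-D k : ℤ) : ℚ))) =
      χ₈ ((∏ k, D k : ℤ) : ZMod 8) * (-1) ^ m.choose 2 := by
  have hs := isHasseSymbol_ratSign 2
  have hA0 : ∀ k, A k ≠ 0 := fun k h => hA k (h ▸ dvd_zero 2)
  have hα : ∀ k, ((2 * A k : ℤ) : ℚ) ≠ 0 := fun k => by exact_mod_cast mul_ne_zero two_ne_zero (hA0 k)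
  have hβ : ∀ k, ((-D k : ℤ) : ℚ) ≠ 0 := fun k => by
    have h2 := not_two_dvd_of_mod_four (hD k)
    have hDk : D k ≠ 0 := by
      intro h; rw [h] at h2; exact h2 (dvd_zero 2)
    exact_mod_cast neg_ne_zero.mpr hDk
  rw [hasseProd_append_mul_self hs _ _ hα hβ]
  -- (i) `(∏ 2A, ∏ 2A)_2 = χ₄(∏ A)`
  have hPA : ¬ (2 : ℤ) ∣ ∏ k, A k := fun h => by
    obtain ⟨k, -, hk⟩ := Int.prime_two.exists_mem_finset_dvd h
    exact hA k hk
  have h1 : ratSign 2 (∏ k, ((2 * A k : ℤ) : ℚ)) (∏ k, ((2 * A k : ℤ) : ℚ)) = χ₄ ((∏ k, A k : ℤ) : ZMod 4) := by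
    rw [← Int.cast_prod, ratSign_intCast, localSign_two, prod_two_mul,
      localSignTwo_two_pow_mul_self hPA]
  -- (ii) `(2Aₖ, -Dₖ)_2 = χ₄(Aₖ) χ₈(Dₖ)`
  have h2 : ∀ k, ratSign 2 ((2 * A k : ℤ) : ℚ) ((-D k : ℤ) : ℚ) = χ₄ (A k : ZMod 4) * χ₈ (D k : ZMod 8) :=
    fun k => by rw [ratSign_intCast, localSign_two, localSignTwo_two_mul_neg (hA k) (hD k)]
  -- (iii) `∏_{k<l} (-Dₖ, -Dₗ)_2 = (-1)^{C(m,2)}`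
  have h3 : hasseProd (ratSign 2) (fun k => ((-D k : ℤ) : ℚ)) = (-1) ^ m.choose 2 := by
    rw [← prod_prod_ite_neg_one m]
    unfold hasseProd
    refine prod_congr rfl fun k _ => prod_congr rfl fun l _ => ?_
    split_ifs
    · rw [ratSign_intCast, localSign_two, localSignTwo_neg_neg (hD k) (hD l)]
    · rfl
  rw [h1, prod_congr rfl fun k _ => h2 k, h3, prod_mul_distrib]
  -- `χ₄(∏A) ∏χ₄(Aₖ) = 1`, `∏χ₈(Dₖ) = χ₈(∏D)`
  have h4 : (∏ k, χ₄ (A k : ZMod 4)) = χ₄ ((∏ k, A k : ℤ) : ZMod 4) := by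
    rw [Int.cast_prod, map_prod]
  have h5 : (∏ k, χ₈ (D k : ZMod 8)) = χ₈ ((∏ k, D k : ℤ) : ZMod 8) := by
    rw [Int.cast_prod, map_prod]
  have hPAodd : Odd (∏ k, A k) := odd_of_not_two_dvd hPA
  rw [h4, h5, ← mul_assoc, χ₄_mul_self_of_odd hPAodd, one_mul]

end Two

/-! ### The product formula for Hasse products -/

/-- **Hilbert's product formula for Hasse products** (Serre, Ch. III §2.1 Thm. 3 with Ch. IV §3.1,
`∏_v ε_v(f) = 1`): for non-zero integers `Nᵢ` and a finite set `S` of odd primes containing the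
odd prime divisors of all `Nᵢ`, `ε_∞ · ε₂ · ∏_{p ∈ S} εₚ = 1`, each `ε_v` being the Hasse product of
the `Nᵢ` for the explicit symbol at `v` (termwise `totalSign_eq_one`). [cite: Serre1973, Ch. IV §3.1] -/
theorem hasseProd_totalSign_eq_one {k : ℕ} (N : Fin k → ℤ) (hN : ∀ i, N i ≠ 0) (S : Finset ℕ)
    (hS : ∀ q ∈ S, q.Prime ∧ q ≠ 2)
    (hSN : ∀ i (q : ℕ), q.Prime → q ≠ 2 → (q : ℤ) ∣ N i → q ∈ S) :
    hasseProd ratSignInfty (fun i => (N i : ℚ)) * hasseProd (ratSign 2) (fun i => (N i : ℚ)) *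
      ∏ q ∈ S, hasseProd (ratSign q) (fun i => (N i : ℚ)) = 1 := by
  have hterm : ∀ i j, totalSign S (N i) (N j) = 1 := fun i j =>
    totalSign_eq_one S hS (hN i) (hN j) (hSN i) (hSN j)
  have hq : ∀ q ∈ S, ∀ a b, localSign q a b = localSignOdd q a b := fun q hq a b => by
    simp [localSign, (hS q hq).2]
  -- everything as double products of integer signs
  simp only [hasseProd_ratSignInfty_intCast, hasseProd_ratSign_intCast, localSign_two]
  have hcomm : (∏ q ∈ S, ∏ i : Fin k, ∏ j : Fin k, if i < j then localSign q (N i) (N j) else 1) =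
      ∏ i : Fin k, ∏ j : Fin k, ∏ q ∈ S, if i < j then localSign q (N i) (N j) else 1 := by
    rw [Finset.prod_comm]
    exact prod_congr rfl fun i _ => Finset.prod_comm
  have key : ∏ i : Fin k, ∏ j : Fin k, ((if i < j then localSignInfty (N i) (N j) else 1) *
      (if i < j then localSignTwo (N i) (N j) else 1) *
      ∏ q ∈ S, if i < j then localSign q (N i) (N j) else 1) = 1 := by
    refine prod_eq_one fun i _ => prod_eq_one fun j _ => ?_
    split_ifs with hij
    · rw [← hterm i j, prod_congr rfl fun q hq' => hq q hq' (N i) (N j)]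
      rfl
    · simp
  simp only [prod_mul_distrib] at key
  rwa [hcomm]

end Literature.NumberTheory.QuadraticForms
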